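import Literature.NumberTheory.Automorphic.GaloisConjugateForms
import Literature.NumberTheory.Automorphic.ModularFormCoefficientField
import Literature.FieldTheory.AlgClosed.AutomorphismExtension
import Mathlib.Analysis.Complex.Cardinality
import Literature.NumberTheory.EllipticCurves.ModularCurveSturmWidthProofs
import HarnessLib

/-!
# Galois conjugates of modular forms on finite-index subgroups (all weights), and CDT Remark 59

Final file of the analytic proof of the Galois-conjugation input `hB` of Calegari–Dimitrov–Tang,
*The unbounded denominators conjecture* (J. Amer. Math. Soc. **38** (2025), arXiv:2109.09040),
Remark 59: **the conjugates of the `q`-expansion of a modular form of weight `k` on a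
finite-index subgroup of `SL(2, ℤ)` under any automorphism of `ℂ` are again `q`-expansions of
modular forms of weight `k` on finite-index subgroups** (`exists_conjugate_modularForm`), in the
exact shape `hB` consumed by `…_algInt.of_unboundedDenominators_of_hB`
(`galois_conjugate_hB`); consequently the algebraic-integer version
`CalegariDimitrovTang2025_unboundedDenominators_algInt` of the unbounded denominators theorem
follows from the integer version `CalegariDimitrovTang2025_unboundedDenominators` and nothing
else (`CalegariDimitrovTang2025_unboundedDenominators_algInt.of_unboundedDenominators`).

Even weight is `GaloisConjugateForms.exists_conjugate_modularForm_even`; negative weight forms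
vanish (`f² V^{-k}` is a weight-zero form tending to `0` at `i∞`, and `dim M₀ ≤ 1`); odd weight
`k ≥ 1` is reduced to even weight by the two twists `f θ²` and `f (θ²|T)` (`θ²` the weight-one
form of `exists_modularForm_thetaSq`): the quotient `f' = (fθ²)'/θ² = (f θ²|T)'/(θ²|T)` is
bounded at every cusp because `(θ²|A)² = U|A` and `((θ²|T)|A)² = W|A` are never both `±V`.

No definitions, no named facts.

## References

* [CalegariDimitrovTang2025] arXiv:2109.09040, Remark 59 (and Remark 58, Theorem 1).
-/

noncomputable section

open Complex Filter Topology Function Metric Set Polynomial Cardinal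
open UpperHalfPlane hiding I
open scoped Real Topology MatrixGroups Manifold ModularForm

namespace Literature.NumberTheory.Automorphic

namespace ModularLambda

open Literature.NumberTheory.EllipticCurves.JacobiThetaNull
open Literature.NumberTheory.ModularForms (thetaU thetaV thetaW thetaU_apply thetaV_apply
  thetaW_apply thetaU_ne_zero thetaV_ne_zero thetaW_ne_zero mdifferentiable_thetaU
  mdifferentiable_thetaV mdifferentiable_thetaW tendsto_thetaU tendsto_thetaW tendsto_thetaV
  thetaU_eq_thetaV_add_thetaW thetaU_slash_T slash_T_apply)
open Literature.NumberTheory.ModularForms.QExpansionAlgebra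
open ModularGroup Matrix.SpecialLinearGroup

/-! ### Products and translates of modular forms on finite-index subgroups -/

/-- **Product of modular forms on two finite-index subgroups**, as a modular form on the
intersection. [folklore] -/
theorem exists_modularForm_mul {Γa Γb : Subgroup SL(2, ℤ)} [Γa.FiniteIndex] [Γb.FiniteIndex]
    {ka kb kc : ℤ} (hk : kc = ka + kb) (fa : ModularForm (Γa : Subgroup (GL (Fin 2) ℝ)) ka)
    (fb : ModularForm (Γb : Subgroup (GL (Fin 2) ℝ)) kb) :
    ∃ g : ModularForm ((Γa ⊓ Γb : Subgroup SL(2, ℤ)) : Subgroup (GL (Fin 2) ℝ)) kc,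
      (⇑g : ℍ → ℂ) = ⇑fa * ⇑fb := by
  subst hk
  have hslash : ∀ A : SL(2, ℤ), (⇑fa * ⇑fb) ∣[ka + kb] A = (⇑fa ∣[ka] A) * (⇑fb ∣[kb] A) := fun A ↦
    ModularForm.mul_slash_SL2 ka kb A _ _
  have hinva : ∀ γ : SL(2, ℤ), γ ∈ Γa → (⇑fa) ∣[ka] γ = ⇑fa := fun γ hγ ↦ by
    funext z
    rw [ModularForm.SL_slash_apply, SlashInvariantForm.slash_action_eqn_SL'' fa hγ z, mul_comm,
      ← mul_assoc, ← zpow_add₀ (denom_ne_zero _ _), neg_add_cancel, zpow_zero, one_mul]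
  have hinvb : ∀ γ : SL(2, ℤ), γ ∈ Γb → (⇑fb) ∣[kb] γ = ⇑fb := fun γ hγ ↦ by
    funext z
    rw [ModularForm.SL_slash_apply, SlashInvariantForm.slash_action_eqn_SL'' fb hγ z, mul_comm,
      ← mul_assoc, ← zpow_add₀ (denom_ne_zero _ _), neg_add_cancel, zpow_zero, one_mul]
  refine ⟨{ toFun := ⇑fa * ⇑fb
            slash_action_eq' := ?_
            holo' := (ModularFormClass.holo fa).mul (ModularFormClass.holo fb)
            bdd_at_cusps' := ?_ }, rfl⟩
  · intro γ hγ
    obtain ⟨A, hA, rfl⟩ := Subgroup.mem_map.mp hγ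
    obtain ⟨hAa, hAb⟩ := Subgroup.mem_inf.mp hA
    show (⇑fa * ⇑fb) ∣[ka + kb] (A : GL (Fin 2) ℝ) = ⇑fa * ⇑fb
    rw [← ModularForm.SL_slash, hslash, hinva A hAa, hinvb A hAb]
  · intro c hc
    rw [Subgroup.IsArithmetic.isCusp_iff_isCusp_SL2Z] at hc
    rw [OnePoint.isBoundedAt_iff_forall_SL2Z hc]
    intro g _
    show IsBoundedAtImInfty ((⇑fa * ⇑fb) ∣[ka + kb] g)
    rw [hslash]
    exact (ModularFormClass.bdd_at_infty_slash fa g).mul (ModularFormClass.bdd_at_infty_slash fb g)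

/-- **Translate of a modular form**: `E|ₖB` (`B ∈ SL(2, ℤ)`) is a modular form on the
finite-index subgroup `B⁻¹ Γ B`. [folklore] -/
theorem exists_modularForm_slash {Γ : Subgroup SL(2, ℤ)} [Γ.FiniteIndex] {k : ℤ}
    (E : ModularForm (Γ : Subgroup (GL (Fin 2) ℝ)) k) (B : SL(2, ℤ)) :
    ∃ (Γ₂ : Subgroup SL(2, ℤ)) (_ : Γ₂.FiniteIndex)
      (E' : ModularForm (Γ₂ : Subgroup (GL (Fin 2) ℝ)) k),
      (⇑E' : ℍ → ℂ) = (⇑E) ∣[k] B ∧ ∀ γ : SL(2, ℤ), B * γ * B⁻¹ ∈ Γ → γ ∈ Γ₂ := by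
  have hinv : ∀ γ : SL(2, ℤ), γ ∈ Γ → (⇑E) ∣[k] γ = ⇑E := fun γ hγ ↦ by
    funext z
    rw [ModularForm.SL_slash_apply, SlashInvariantForm.slash_action_eqn_SL'' E hγ z, mul_comm,
      ← mul_assoc, ← zpow_add₀ (denom_ne_zero _ _), neg_add_cancel, zpow_zero, one_mul]
  set Γ₂ : Subgroup SL(2, ℤ) := Γ.comap (MulAut.conj B).toMonoidHom with hΓ₂
  have hmem : ∀ γ : SL(2, ℤ), γ ∈ Γ₂ ↔ B * γ * B⁻¹ ∈ Γ := fun γ ↦ by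
    simp [hΓ₂, Subgroup.mem_comap]
  haveI hfi : Γ₂.FiniteIndex := by
    have hsurj : Function.Surjective ((MulAut.conj B).toMonoidHom : SL(2, ℤ) →* SL(2, ℤ)) :=
      (MulAut.conj B).surjective
    refine ⟨?_⟩
    rw [hΓ₂, Subgroup.index_comap_of_surjective _ hsurj]
    exact Subgroup.FiniteIndex.index_ne_zero
  refine ⟨Γ₂, hfi,
    { toFun := (⇑E) ∣[k] B
      slash_action_eq' := ?_
      holo' := by
        show MDiff ((⇑E) ∣[k] (B : GL (Fin 2) ℝ))
        exact (ModularFormClass.holo E).slash k _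
      bdd_at_cusps' := ?_ }, rfl, fun γ hγ ↦ (hmem γ).mpr hγ⟩
  · intro γ hγ
    obtain ⟨A, hA, rfl⟩ := Subgroup.mem_map.mp hγ
    show ((⇑E) ∣[k] B) ∣[k] (A : GL (Fin 2) ℝ) = (⇑E) ∣[k] B
    rw [← ModularForm.SL_slash, ← SlashAction.slash_mul,
      show B * A = B * A * B⁻¹ * B by rw [inv_mul_cancel_right], SlashAction.slash_mul,
      hinv _ ((hmem A).mp hA)]
  · intro c hc
    rw [Subgroup.IsArithmetic.isCusp_iff_isCusp_SL2Z] at hc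
    rw [OnePoint.isBoundedAt_iff_forall_SL2Z hc]
    intro g _
    show IsBoundedAtImInfty (((⇑E) ∣[k] B) ∣[k] g)
    rw [← SlashAction.slash_mul]
    exact ModularFormClass.bdd_at_infty_slash E (B * g)

/-! ### Negative weight -/

/-- **Modular forms of negative weight on finite-index subgroups vanish**: `f² V^{-k}` is a
modular form of weight `0` on `Γ ∩ Γ(2)`, hence constant (`dim M₀ ≤ 1`, Sturm), and it tends to
`0` at `i∞` (`V → 0`), so it is `0`; as `V ≠ 0` on `ℍ`, `f = 0`. [folklore] -/
theorem modularForm_neg_weight_eq_zero {Γ : Subgroup SL(2, ℤ)} [Γ.FiniteIndex] {k : ℤ}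
    (hk : k < 0) (f : ModularForm (Γ : Subgroup (GL (Fin 2) ℝ)) k) : (⇑f : ℍ → ℂ) = 0 := by
  set m : ℕ := (-k).toNat with hm
  have hmk : (m : ℤ) = -k := by rw [hm]; omega
  set G2 : Subgroup SL(2, ℤ) := CongruenceSubgroup.Gamma 2 with hG2
  set Γ' : Subgroup SL(2, ℤ) := Γ ⊓ G2 with hΓ'
  haveI : Γ'.FiniteIndex := inferInstance
  set F : ℍ → ℂ := (⇑f) ^ 2 * thetaV ^ m with hF
  have hslash : ∀ A : SL(2, ℤ), F ∣[(0 : ℤ)] A = ((⇑f) ∣[k] A) ^ 2 * (thetaV ∣[(2 : ℤ)] A) ^ m := by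
    intro A
    rw [hF, show (0 : ℤ) = (2 : ℕ) * k + (m : ℤ) * 2 by push_cast; omega, ModularForm.mul_slash_SL2,
      pow_slash, pow_slash]
  have hfinv : ∀ γ : SL(2, ℤ), γ ∈ Γ → (⇑f) ∣[k] γ = ⇑f := fun γ hγ ↦ by
    funext z
    rw [ModularForm.SL_slash_apply, SlashInvariantForm.slash_action_eqn_SL'' f hγ z, mul_comm,
      ← mul_assoc, ← zpow_add₀ (denom_ne_zero _ _), neg_add_cancel, zpow_zero, one_mul]
  have hFd : MDiff F := ((ModularFormClass.holo f).pow 2).mul (mdifferentiable_thetaV.pow m)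
  let g : ModularForm (Γ' : Subgroup (GL (Fin 2) ℝ)) 0 :=
    { toFun := F
      slash_action_eq' := by
        intro γ hγ
        obtain ⟨A, hA, rfl⟩ := Subgroup.mem_map.mp hγ
        obtain ⟨hA1, hA2⟩ := Subgroup.mem_inf.mp hA
        show F ∣[(0 : ℤ)] (A : GL (Fin 2) ℝ) = F
        rw [← ModularForm.SL_slash, hslash, hfinv A hA1, thetaV_slash_eq_of_mem_Gamma_two hA2]
      holo' := hFd
      bdd_at_cusps' := by
        intro c hc
        rw [Subgroup.IsArithmetic.isCusp_iff_isCusp_SL2Z] at hc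
        rw [OnePoint.isBoundedAt_iff_forall_SL2Z hc]
        intro A _
        show IsBoundedAtImInfty (F ∣[(0 : ℤ)] A)
        rw [hslash]
        exact (isBoundedAtImInfty_pow (ModularFormClass.bdd_at_infty_slash f A) 2).mul
          (isBoundedAtImInfty_pow (isBoundedAtImInfty_of_mem_six (slash_mem_six A thetaV (by simp))) m) }
  -- `dim M₀(Γ') ≤ 1`, so `g` is a multiple of the constant form `1`
  haveI := Literature.NumberTheory.EllipticCurves.ModularForms.finiteDimensional_modularForm_of_finiteIndex Γ' 0
  have hdim := Literature.NumberTheory.EllipticCurves.ModularForms.finrank_modularForm_le_index_mul Γ' 0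
  simp only [zero_mul, Int.toNat_zero, Nat.zero_div, mul_zero, zero_add] at hdim
  obtain ⟨v, hv⟩ := finrank_le_one_iff.mp hdim
  obtain ⟨c₁, hc₁⟩ := hv (ModularForm.const 1)
  obtain ⟨c₂, hc₂⟩ := hv g
  have hc₁0 : c₁ ≠ 0 := by
    rintro rfl
    rw [zero_smul] at hc₁
    have := congrArg (fun F : ModularForm (Γ' : Subgroup (GL (Fin 2) ℝ)) 0 ↦ (F : ℍ → ℂ) UpperHalfPlane.I) hc₁
    simp at this
  have hgc : (⇑g : ℍ → ℂ) = fun _ ↦ c₂ * c₁⁻¹ := by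
    have hv' : v = c₁⁻¹ • ModularForm.const 1 := by
      rw [← hc₁, smul_smul, inv_mul_cancel₀ hc₁0, one_smul]
    rw [← hc₂, hv', smul_smul]
    funext z
    simp
  -- `g → 0` at `i∞`
  have hlim : Tendsto (⇑g : ℍ → ℂ) atImInfty (𝓝 0) := by
    have h1 : Tendsto (thetaV ^ m) atImInfty (𝓝 0) := by
      have hm0 : m ≠ 0 := by omega
      have := tendsto_thetaV.pow m
      rw [zero_pow hm0] at this
      exact this
    have h2 : IsBoundedAtImInfty ((⇑f) ^ 2) := isBoundedAtImInfty_pow (ModularFormClass.bdd_at_infty f) 2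
    show Tendsto F atImInfty (𝓝 0)
    obtain ⟨C, hC⟩ := Asymptotics.isBigO_iff.mp h2
    have h3 : F =O[atImInfty] (thetaV ^ m) := Asymptotics.IsBigO.of_bound C (by
      filter_upwards [hC] with τ hτ
      simp only [Pi.one_apply, norm_one, mul_one] at hτ
      simp only [hF, Pi.mul_apply, norm_mul]
      exact mul_le_mul_of_nonneg_right hτ (norm_nonneg _))
    exact h3.trans_tendsto h1
  have hc : c₂ * c₁⁻¹ = 0 := by
    rw [hgc] at hlim
    exact tendsto_nhds_unique tendsto_const_nhds hlim
  have hF0 : F = 0 := by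
    have : (⇑g : ℍ → ℂ) = F := rfl
    rw [← this, hgc, hc]
    rfl
  funext z
  have hz := congrFun hF0 z
  simp only [hF, Pi.mul_apply, Pi.pow_apply, Pi.zero_apply] at hz
  have hm0 : m ≠ 0 := by omega
  rcases mul_eq_zero.mp hz with h | h
  · exact (pow_eq_zero_iff two_ne_zero).mp h
  · exact absurd ((pow_eq_zero_iff hm0).mp h) (thetaV_ne_zero z)

/-! ### Nice modular forms; the theta square -/

/-- A modular form with a positive strict period `H` is nice of period `H`. [folklore] -/
theorem nice_of_modularForm {Γ : Subgroup (GL (Fin 2) ℝ)} {k : ℤ} (F : ModularForm Γ k) {H : ℝ}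
    (hH : 0 < H) (hΓ : H ∈ Γ.strictPeriods) :
    Periodic ((⇑F) ∘ ofComplex) H ∧ MDiff ⇑F ∧ IsBoundedAtImInfty ⇑F := by
  haveI : Fact (IsCusp OnePoint.infty Γ) := ⟨Γ.isCusp_of_mem_strictPeriods hH hΓ⟩
  exact ⟨SlashInvariantFormClass.periodic_comp_ofComplex F hΓ, ModularFormClass.holo F,
    ModularFormClass.bdd_at_infty F⟩

/-- `‖X‖ → 1` at `i∞` for `X ∈ {±U, ±W}`. [folklore] -/
theorem tendsto_norm_of_mem_four {X : ℍ → ℂ}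
    (hX : X = thetaU ∨ X = -thetaU ∨ X = thetaW ∨ X = -thetaW) :
    Tendsto (fun z ↦ ‖X z‖) atImInfty (𝓝 1) := by
  have hU : Tendsto (fun z ↦ ‖thetaU z‖) atImInfty (𝓝 1) := by
    simpa using tendsto_thetaU.norm
  have hW : Tendsto (fun z ↦ ‖thetaW z‖) atImInfty (𝓝 1) := by
    simpa using tendsto_thetaW.norm
  rcases hX with rfl | rfl | rfl | rfl
  · exact hU
  · simpa using hU
  · exact hW
  · simpa using hW

/-- `U|₂A` and `W|₂A` are never both in `{±V}` (`A ∈ SL(2, ℤ)`): otherwise `U = ±W` on `ℍ`,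
so `V = U − W ∈ {0, −2W}`, contradicting `V ≠ 0`, `V → 0`, `W → 1` at `i∞`. [folklore] -/
theorem not_both_thetaV (A : SL(2, ℤ))
    (hU : thetaU ∣[(2 : ℤ)] A = thetaV ∨ thetaU ∣[(2 : ℤ)] A = -thetaV)
    (hW : thetaW ∣[(2 : ℤ)] A = thetaV ∨ thetaW ∣[(2 : ℤ)] A = -thetaV) : False := by
  -- `U (A z) = ε W (A z)` with `ε = ±1`
  obtain ⟨ε, hε, hUW⟩ : ∃ ε : ℂ, (ε = 1 ∨ ε = -1) ∧ ∀ z : ℍ, thetaU (A • z) = ε * thetaW (A • z) := by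
    have key : ∀ (ε₁ ε₂ : ℂ), thetaU ∣[(2 : ℤ)] A = ε₁ • thetaV → thetaW ∣[(2 : ℤ)] A = ε₂ • thetaV →
        ε₂ ≠ 0 → ∀ z : ℍ, thetaU (A • z) = (ε₁ / ε₂) * thetaW (A • z) := by
      intro ε₁ ε₂ h1 h2 hε₂ z
      have e1 := congrFun h1 z
      have e2 := congrFun h2 z
      rw [ModularForm.SL_slash_apply, Pi.smul_apply, smul_eq_mul] at e1 e2
      have hd : denom (A : GL (Fin 2) ℝ) z ^ (-(2 : ℤ)) ≠ 0 := zpow_ne_zero _ (denom_ne_zero _ _)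
      have hV : thetaV z ≠ 0 := thetaV_ne_zero z
      field_simp
      have := congrArg (· * ε₂) e1
      rw [show ε₁ * thetaV z * ε₂ = ε₁ * (ε₂ * thetaV z) by ring, ← e2] at this
      have h3 : (thetaU (A • z) * ε₂ - ε₁ * thetaW (A • z)) * denom (A : GL (Fin 2) ℝ) z ^ (-(2 : ℤ)) = 0 := by
        rw [sub_mul]; linear_combination this
      rcases mul_eq_zero.mp h3 with h | h
      · linear_combination h
      · exact absurd h hd
    rcases hU with h1 | h1 <;> rcases hW with h2 | h2
    · exact ⟨1, Or.inl rfl, by simpa using key 1 1 (by simpa using h1) (by simpa using h2) one_ne_zero⟩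
    · exact ⟨-1, Or.inr rfl, by simpa using key 1 (-1) (by simpa using h1) (by simpa using h2) (by norm_num)⟩
    · exact ⟨-1, Or.inr rfl, by simpa using key (-1) 1 (by simpa using h1) (by simpa using h2) one_ne_zero⟩
    · exact ⟨1, Or.inl rfl, by simpa using key (-1) (-1) (by simpa using h1) (by simpa using h2) (by norm_num)⟩
  have hUW' : ∀ w : ℍ, thetaU w = ε * thetaW w := fun w ↦ by
    simpa using hUW (A⁻¹ • w)
  have hVW : ∀ w : ℍ, thetaV w = (ε - 1) * thetaW w := fun w ↦ by
    have := congrFun thetaU_eq_thetaV_add_thetaW w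
    simp only [Pi.add_apply] at this
    rw [hUW' w] at this
    linear_combination (-1 : ℂ) * this
  rcases hε with rfl | rfl
  · exact thetaV_ne_zero UpperHalfPlane.I (by rw [hVW]; ring)
  · have h1 : Tendsto (fun z ↦ ‖thetaV z‖) atImInfty (𝓝 0) := by simpa using tendsto_thetaV.norm
    have h2 : Tendsto (fun z ↦ ‖thetaV z‖) atImInfty (𝓝 2) := by
      have : (fun z ↦ ‖thetaV z‖) = fun z ↦ 2 * ‖thetaW z‖ := by
        funext z; rw [hVW z]; simp; norm_num
      rw [this]
      simpa using (tendsto_thetaW.norm).const_mul 2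
    have := tendsto_nhds_unique h1 h2
    norm_num at this

/-! ### Odd weight -/

/-- **Galois conjugates of modular forms of odd weight on finite-index subgroups** (twist by
the weight-one theta form `θ²` and by `θ²|T`, apply the even case, untwist). Same statement as
`exists_conjugate_modularForm_even`, for the weight `2k + 1`.
[cite: CalegariDimitrovTang2025, Remark 59 (input)] -/
theorem exists_conjugate_modularForm_odd {Γ : Subgroup SL(2, ℤ)} [Γ.FiniteIndex] (k : ℕ)
    (f : ModularForm (Γ : Subgroup (GL (Fin 2) ℝ)) (2 * k + 1 : ℤ)) {h : ℕ} (hh : 0 < h)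
    (hΓ : (h : ℝ) ∈ (Γ : Subgroup (GL (Fin 2) ℝ)).strictPeriods) (σ : ℂ ≃+* ℂ) :
    ∃ (Γ' : Subgroup SL(2, ℤ)) (_ : Γ'.FiniteIndex)
      (f' : ModularForm (Γ' : Subgroup (GL (Fin 2) ℝ)) (2 * k + 1 : ℤ)),
      (h : ℝ) ∈ (Γ' : Subgroup (GL (Fin 2) ℝ)).strictPeriods ∧
      ∀ n, (qExpansion (h : ℝ) f').coeff n = σ ((qExpansion (h : ℝ) f).coeff n) := by
  classical
  -- ### the theta forms `E = θ²` on `Γ₁` and `Et = θ²|T` on `Γ₂`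
  obtain ⟨Γ₁, hΓ₁fi, E, -, h2Γ₁, hE⟩ := exists_modularForm_thetaSq
  haveI := hΓ₁fi
  obtain ⟨Γ₂, hΓ₂fi, Et, hEt, hΓ₂mem⟩ := exists_modularForm_slash E ModularGroup.T
  haveI := hΓ₂fi
  have hT2Γ₁ : ModularGroup.T ^ 2 ∈ Γ₁ :=
    T_pow_mem_of_mem_strictPeriods (Γ := Γ₁) (n := 2) (by exact_mod_cast h2Γ₁)
  have hT2Γ₂ : ModularGroup.T ^ 2 ∈ Γ₂ := hΓ₂mem _ (by
    rw [show ModularGroup.T * ModularGroup.T ^ 2 * ModularGroup.T⁻¹ = ModularGroup.T ^ 2 by group]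
    exact hT2Γ₁)
  have hThΓ : ModularGroup.T ^ h ∈ Γ := T_pow_mem_of_mem_strictPeriods hΓ
  -- ### the twisted forms of even weight `2(k+1)`
  obtain ⟨g, hg⟩ := exists_modularForm_mul (kc := 2 * (k + 1 : ℕ)) (by push_cast; ring) f E
  obtain ⟨gt, hgt⟩ := exists_modularForm_mul (kc := 2 * (k + 1 : ℕ)) (by push_cast; ring) f Et
  have h2h : 0 < 2 * h := by omega
  have hper1 : ((2 * h : ℕ) : ℝ) ∈ ((Γ ⊓ Γ₁ : Subgroup SL(2, ℤ)) : Subgroup (GL (Fin 2) ℝ)).strictPeriods := by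
    refine mem_strictPeriods_of_T_pow_mem (Subgroup.mem_inf.mpr ⟨?_, ?_⟩)
    · rw [mul_comm, pow_mul]; exact pow_mem hThΓ 2
    · rw [pow_mul]; exact pow_mem hT2Γ₁ h
  have hper2 : ((2 * h : ℕ) : ℝ) ∈ ((Γ ⊓ Γ₂ : Subgroup SL(2, ℤ)) : Subgroup (GL (Fin 2) ℝ)).strictPeriods := by
    refine mem_strictPeriods_of_T_pow_mem (Subgroup.mem_inf.mpr ⟨?_, ?_⟩)
    · rw [mul_comm, pow_mul]; exact pow_mem hThΓ 2
    · rw [pow_mul]; exact pow_mem hT2Γ₂ h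
  obtain ⟨Γa, hΓafi, g', hΓaper, hg'⟩ := exists_conjugate_modularForm_even (k + 1) g h2h hper1 σ
  obtain ⟨Γb, hΓbfi, gt', hΓbper, hgt'⟩ := exists_conjugate_modularForm_even (k + 1) gt h2h hper2 σ
  haveI := hΓafi
  haveI := hΓbfi
  -- ### the functions `Ef = θ₃²`, `Etf = θ₄²`
  set H : ℝ := ((2 * h : ℕ) : ℝ) with hHdef
  have hH : 0 < H := by rw [hHdef]; exact_mod_cast h2h
  have hHh : H = (h : ℝ) * 2 := by rw [hHdef]; push_cast; ring
  set Θ : ℍ → ℂ := fun τ ↦ theta3 τ with hΘ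
  set Θt : ℍ → ℂ := fun τ ↦ Θ ((1 : ℝ) +ᵥ τ) with hΘt
  have hEf : (⇑E : ℍ → ℂ) = Θ ^ 2 := by
    rw [hE]; funext τ; simp [hΘ, jacobiTheta_eq_jacobiTheta₂, theta3]
  have hEtf : (⇑Et : ℍ → ℂ) = Θt ^ 2 := by
    rw [hEt, hE]
    funext τ
    rw [thetaSq_slash_T_apply]
    simp [hΘt, hΘ, jacobiTheta_eq_jacobiTheta₂, theta3, coe_vadd, add_comm]
  have hΘnice : Periodic (Θ ∘ ofComplex) H ∧ MDiff Θ ∧ IsBoundedAtImInfty Θ := by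
    rw [hHh]; exact nice_theta3 h
  have hΘtnice : Periodic (Θt ∘ ofComplex) H ∧ MDiff Θt ∧ IsBoundedAtImInfty Θt := nice_vadd_one hΘnice
  have hΘ0 : ∀ τ : ℍ, Θ τ ≠ 0 := fun τ ↦ theta3_ne_zero τ.im_pos
  have hΘt0 : ∀ τ : ℍ, Θt τ ≠ 0 := fun τ ↦ theta3_ne_zero ((1 : ℝ) +ᵥ τ).im_pos
  have hE0 : ∀ τ : ℍ, (E : ℍ → ℂ) τ ≠ 0 := fun τ ↦ by rw [hEf]; exact pow_ne_zero _ (hΘ0 τ)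
  have hEt0 : ∀ τ : ℍ, (Et : ℍ → ℂ) τ ≠ 0 := fun τ ↦ by rw [hEtf]; exact pow_ne_zero _ (hΘt0 τ)
  -- rationality of the expansions of `Θ`, `Θt`
  obtain ⟨a, ha0, -, ha⟩ := exists_coeff_qExpansion_theta3_eq hh
  have hΘrat : ∀ n, (qExpansion H Θ).coeff n ∈ Set.range ((↑) : ℚ → ℂ) := by
    intro n
    rw [hHh, hΘ, ha n]
    split_ifs
    · exact ⟨a (n / h), by simp⟩
    · exact ⟨0, by simp⟩
  have hΘtrat : ∀ n, (qExpansion H Θt).coeff n ∈ Set.range ((↑) : ℚ → ℂ) := by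
    intro n
    rw [hΘt, qExpansion_vadd_one_coeff hH hΘnice n, hHh, hΘ, ha n]
    split_ifs with hdvd
    · obtain ⟨j, rfl⟩ := hdvd
      refine ⟨(-1) ^ j * a (h * j / h), ?_⟩
      have hexp : cexp (2 * π * Complex.I / (((h : ℝ) * 2 : ℝ) : ℂ)) ^ (h * j) = (-1) ^ j := by
        rw [← Complex.exp_nat_mul, ← Complex.exp_pi_mul_I, ← Complex.exp_nat_mul]
        congr 1
        have hh0 : (h : ℂ) ≠ 0 := Nat.cast_ne_zero.mpr hh.ne'
        push_cast
        field_simp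
      rw [hexp]
      push_cast
      ring
    · exact ⟨0, by simp⟩
  have hErat : ∀ n, (qExpansion H ⇑E).coeff n ∈ Set.range ((↑) : ℚ → ℂ) := by
    rw [hEf, qExpansion_pow_of_nice hH hΘnice]
    exact coeff_pow_mem_range_ratCast hΘrat 2
  have hEtrat : ∀ n, (qExpansion H ⇑Et).coeff n ∈ Set.range ((↑) : ℚ → ℂ) := by
    rw [hEtf, qExpansion_pow_of_nice hH hΘtnice]
    exact coeff_pow_mem_range_ratCast hΘtrat 2
  have hEnice : Periodic ((⇑E) ∘ ofComplex) H ∧ MDiff ⇑E ∧ IsBoundedAtImInfty ⇑E := by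
    rw [hEf]; exact nice_pow hΘnice 2
  have hEtnice : Periodic ((⇑Et) ∘ ofComplex) H ∧ MDiff ⇑Et ∧ IsBoundedAtImInfty ⇑Et := by
    rw [hEtf]; exact nice_pow hΘtnice 2
  have hE00 : (qExpansion H ⇑E).coeff 0 ≠ 0 := by
    rw [hEf, qExpansion_pow_of_nice hH hΘnice, PowerSeries.coeff_zero_eq_constantCoeff, map_pow,
      ← PowerSeries.coeff_zero_eq_constantCoeff, hHh, hΘ, ha 0]
    simp [ha0]
  -- ### expansions of `f, g, gt, g', gt'` at the period `H = 2h`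
  have hΓH : H ∈ ((Γ : Subgroup SL(2, ℤ)) : Subgroup (GL (Fin 2) ℝ)).strictPeriods := by
    rw [hHdef]
    refine mem_strictPeriods_of_T_pow_mem ?_
    rw [mul_comm, pow_mul]; exact pow_mem hThΓ 2
  have hfnice := nice_of_modularForm f hH hΓH
  have hg'nice := nice_of_modularForm g' hH hΓaper
  have hgt'nice := nice_of_modularForm gt' hH hΓbper
  set σh : PowerSeries ℂ →+* PowerSeries ℂ := PowerSeries.map (σ : ℂ →+* ℂ) with hσh
  have hexp_g' : qExpansion H ⇑g' = σh (qExpansion H ⇑f) * qExpansion H ⇑E := by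
    have h1 : qExpansion H ⇑g' = σh (qExpansion H ⇑g) := by
      ext n; rw [hσh, PowerSeries.coeff_map]; exact hg' n
    rw [h1, hg, qExpansion_mul_of_nice hH hfnice hEnice, map_mul,
      PowerSeries.map_eq_self_of_forall_coeff_ratCast _ hErat]
  have hexp_gt' : qExpansion H ⇑gt' = σh (qExpansion H ⇑f) * qExpansion H ⇑Et := by
    have h1 : qExpansion H ⇑gt' = σh (qExpansion H ⇑gt) := by
      ext n; rw [hσh, PowerSeries.coeff_map]; exact hgt' n
    rw [h1, hgt, qExpansion_mul_of_nice hH hfnice hEtnice, map_mul,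
      PowerSeries.map_eq_self_of_forall_coeff_ratCast _ hEtrat]
  -- ### the untwisted function `F' = g'/E`
  set F' : ℍ → ℂ := fun z ↦ g' z / E z with hF'
  have hF'E : F' * ⇑E = ⇑g' := by
    funext z; simp only [Pi.mul_apply, hF']; field_simp [hE0 z]
  have hF'nice : Periodic (F' ∘ ofComplex) H ∧ MDiff F' ∧ IsBoundedAtImInfty F' := by
    refine ⟨?_, ?_, isBoundedAtImInfty_div_of_nice hH hg'nice hEnice hE00⟩
    · intro x
      have hp := hg'nice.1 x
      have hq := hEnice.1 x
      simp only [comp_apply] at hp hq ⊢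
      simp only [hF', hp, hq]
    · have hA : DifferentiableOn ℂ ((⇑g') ∘ ofComplex) {z : ℂ | 0 < z.im} :=
        UpperHalfPlane.mdifferentiable_iff.mp hg'nice.2.1
      have hB : DifferentiableOn ℂ ((⇑E) ∘ ofComplex) {z : ℂ | 0 < z.im} :=
        UpperHalfPlane.mdifferentiable_iff.mp hEnice.2.1
      refine UpperHalfPlane.mdifferentiable_iff.mpr ?_
      exact hA.div hB fun z _ ↦ hE0 _
  have hexpF' : qExpansion H F' = σh (qExpansion H ⇑f) := by
    have hqE : qExpansion H ⇑E ≠ 0 := by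
      intro h0; rw [h0, map_zero] at hE00; exact hE00 rfl
    have h1 : qExpansion H F' * qExpansion H ⇑E = qExpansion H ⇑g' := by
      rw [← qExpansion_mul_of_nice hH hF'nice hEnice, hF'E]
    rw [hexp_g'] at h1
    exact mul_right_cancel₀ hqE h1
  have hF'Et : F' * ⇑Et = ⇑gt' := by
    refine eq_of_qExpansion_eq hH (nice_mul hF'nice hEtnice) hgt'nice ?_
    rw [qExpansion_mul_of_nice hH hF'nice hEtnice, hexpF', hexp_gt']
  -- ### slash computations
  have hslashE : ∀ A : SL(2, ℤ), (F' ∣[(2 * k + 1 : ℤ)] A) * ((⇑E) ∣[(1 : ℤ)] A) = (⇑g') ∣[(2 * (k + 1 : ℕ) : ℤ)] A := by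
    intro A
    rw [← hF'E, show (2 * (k + 1 : ℕ) : ℤ) = (2 * k + 1) + 1 by push_cast; ring, ModularForm.mul_slash_SL2]
  have hslashEt : ∀ A : SL(2, ℤ), (F' ∣[(2 * k + 1 : ℤ)] A) * ((⇑Et) ∣[(1 : ℤ)] A) = (⇑gt') ∣[(2 * (k + 1 : ℕ) : ℤ)] A := by
    intro A
    rw [← hF'Et, show (2 * (k + 1 : ℕ) : ℤ) = (2 * k + 1) + 1 by push_cast; ring, ModularForm.mul_slash_SL2]
  have hslash_ne : ∀ (X : ℍ → ℂ), (∀ τ, X τ ≠ 0) → ∀ (A : SL(2, ℤ)) (τ : ℍ), (X ∣[(1 : ℤ)] A) τ ≠ 0 := by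
    intro X hX A τ
    rw [ModularForm.SL_slash_apply]
    exact mul_ne_zero (hX _) (zpow_ne_zero _ (denom_ne_zero _ _))
  -- squares of the theta slashes
  have hEsq : ∀ (A : SL(2, ℤ)) (τ : ℍ), ((⇑E) ∣[(1 : ℤ)] A) τ ^ 2 = (thetaU ∣[(2 : ℤ)] A) τ := by
    intro A τ
    have h1 : (⇑E) ^ 2 = thetaU := by
      rw [hEf]; funext τ; simp [hΘ, thetaU_apply, ← pow_mul]
    have := congrFun (pow_slash (⇑E) 1 A 2) τ
    simp only [Nat.cast_ofNat, mul_one, Pi.pow_apply] at this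
    rw [← this, h1]
  have hEtsq : ∀ (A : SL(2, ℤ)) (τ : ℍ), ((⇑Et) ∣[(1 : ℤ)] A) τ ^ 2 = (thetaW ∣[(2 : ℤ)] A) τ := by
    intro A τ
    have h1 : (⇑Et) ^ 2 = thetaW := by
      rw [hEt, ← pow_slash, show (⇑E) ^ 2 = thetaU by
        rw [hEf]; funext τ; simp [hΘ, thetaU_apply, ← pow_mul]]
      simpa using thetaU_slash_T
    have := congrFun (pow_slash (⇑Et) 1 A 2) τ
    simp only [Nat.cast_ofNat, mul_one, Pi.pow_apply] at this
    rw [← this, h1]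
  -- boundedness of `F'|A / 1` from a good theta
  have hbdd_of_good : ∀ (A : SL(2, ℤ)) (Y : ℍ → ℂ) (G'' : ℍ → ℂ) (X : ℍ → ℂ),
      IsBoundedAtImInfty G'' → (∀ τ, (Y ∣[(1 : ℤ)] A) τ ≠ 0) →
      (∀ τ, ((Y ∣[(1 : ℤ)] A) τ) ^ 2 = X τ) →
      Tendsto (fun z ↦ ‖X z‖) atImInfty (𝓝 1) →
      (F' ∣[(2 * k + 1 : ℤ)] A) * (Y ∣[(1 : ℤ)] A) = G'' →
      IsBoundedAtImInfty (F' ∣[(2 * k + 1 : ℤ)] A) := by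
    intro A Y G'' X hG'' hY0 hsq hX hprod
    have hev : ∀ᶠ z in atImInfty, 1 / 4 ≤ ‖X z‖ := by
      exact hX.eventually (Ici_mem_nhds (show (1 / 4 : ℝ) < 1 by norm_num))
    obtain ⟨C, hC⟩ := Asymptotics.isBigO_iff.mp hG''
    refine Asymptotics.IsBigO.of_bound (2 * C) ?_
    filter_upwards [hev, hC] with z hz hCz
    simp only [Pi.one_apply, norm_one, mul_one] at hCz ⊢
    have hYz : 1 / 2 ≤ ‖(Y ∣[(1 : ℤ)] A) z‖ := by
      have h1 : ‖(Y ∣[(1 : ℤ)] A) z‖ ^ 2 = ‖X z‖ := by rw [← norm_pow, hsq]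
      nlinarith [norm_nonneg ((Y ∣[(1 : ℤ)] A) z), norm_nonneg (X z)]
    have hFz : (F' ∣[(2 * k + 1 : ℤ)] A) z = G'' z / (Y ∣[(1 : ℤ)] A) z := by
      rw [← hprod, Pi.mul_apply, mul_div_cancel_right₀ _ (hY0 z)]
    rw [hFz, norm_div]
    calc ‖G'' z‖ / ‖(Y ∣[(1 : ℤ)] A) z‖ ≤ C / (1 / 2) := by
          gcongr
          · exact (norm_nonneg _).trans hCz
      _ = 2 * C := by ring
  have hbddF' : ∀ A : SL(2, ℤ), IsBoundedAtImInfty (F' ∣[(2 * k + 1 : ℤ)] A) := by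
    intro A
    have hUA := thetaU_slash_mem_six A
    have hWA : thetaW ∣[(2 : ℤ)] A ∈ ({thetaU, -thetaU, thetaV, -thetaV, thetaW, -thetaW} : Set (ℍ → ℂ)) := by
      have := thetaU_slash_mem_six (ModularGroup.T * A)
      rwa [SlashAction.slash_mul, thetaU_slash_T] at this
    simp only [Set.mem_insert_iff, Set.mem_singleton_iff] at hUA hWA
    have goodE : (thetaU ∣[(2 : ℤ)] A = thetaU ∨ thetaU ∣[(2 : ℤ)] A = -thetaU ∨
        thetaU ∣[(2 : ℤ)] A = thetaW ∨ thetaU ∣[(2 : ℤ)] A = -thetaW) →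
        IsBoundedAtImInfty (F' ∣[(2 * k + 1 : ℤ)] A) := fun hgood ↦
      hbdd_of_good A ⇑E _ _ (ModularFormClass.bdd_at_infty_slash g' A) (hslash_ne _ hE0 A)
        (hEsq A) (tendsto_norm_of_mem_four hgood) (hslashE A)
    have goodEt : (thetaW ∣[(2 : ℤ)] A = thetaU ∨ thetaW ∣[(2 : ℤ)] A = -thetaU ∨
        thetaW ∣[(2 : ℤ)] A = thetaW ∨ thetaW ∣[(2 : ℤ)] A = -thetaW) →
        IsBoundedAtImInfty (F' ∣[(2 * k + 1 : ℤ)] A) := fun hgood ↦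
      hbdd_of_good A ⇑Et _ _ (ModularFormClass.bdd_at_infty_slash gt' A) (hslash_ne _ hEt0 A)
        (hEtsq A) (tendsto_norm_of_mem_four hgood) (hslashEt A)
    have badcase : (thetaU ∣[(2 : ℤ)] A = thetaV ∨ thetaU ∣[(2 : ℤ)] A = -thetaV) →
        IsBoundedAtImInfty (F' ∣[(2 * k + 1 : ℤ)] A) := fun hUV ↦ by
      rcases hWA with h2 | h2 | h2 | h2 | h2 | h2
      · exact goodEt (Or.inl h2)
      · exact goodEt (Or.inr (Or.inl h2))
      · exact (not_both_thetaV A hUV (Or.inl h2)).elim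
      · exact (not_both_thetaV A hUV (Or.inr h2)).elim
      · exact goodEt (Or.inr (Or.inr (Or.inl h2)))
      · exact goodEt (Or.inr (Or.inr (Or.inr h2)))
    rcases hUA with h1 | h1 | h1 | h1 | h1 | h1
    · exact goodE (Or.inl h1)
    · exact goodE (Or.inr (Or.inl h1))
    · exact badcase (Or.inl h1)
    · exact badcase (Or.inr h1)
    · exact goodE (Or.inr (Or.inr (Or.inl h1)))
    · exact goodE (Or.inr (Or.inr (Or.inr h1)))
  -- ### invariance under `Γa ∩ Γ₁`
  have hg'inv : ∀ γ : SL(2, ℤ), γ ∈ Γa → (⇑g') ∣[(2 * (k + 1 : ℕ) : ℤ)] γ = ⇑g' := fun γ hγ ↦ by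
    funext z
    rw [ModularForm.SL_slash_apply, SlashInvariantForm.slash_action_eqn_SL'' g' hγ z, mul_comm,
      ← mul_assoc, ← zpow_add₀ (denom_ne_zero _ _), neg_add_cancel, zpow_zero, one_mul]
  have hEinv : ∀ γ : SL(2, ℤ), γ ∈ Γ₁ → (⇑E) ∣[(1 : ℤ)] γ = ⇑E := fun γ hγ ↦ by
    funext z
    rw [ModularForm.SL_slash_apply, SlashInvariantForm.slash_action_eqn_SL'' E hγ z, mul_comm,
      ← mul_assoc, ← zpow_add₀ (denom_ne_zero _ _), neg_add_cancel, zpow_zero, one_mul]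
  have hF'inv : ∀ γ ∈ Γa ⊓ Γ₁, F' ∣[(2 * k + 1 : ℤ)] γ = F' := by
    intro γ hγ
    obtain ⟨h1, h2⟩ := Subgroup.mem_inf.mp hγ
    have := hslashE γ
    rw [hEinv γ h2, hg'inv γ h1, ← hF'E] at this
    funext z
    have hz := congrFun this z
    simp only [Pi.mul_apply] at hz
    exact mul_right_cancel₀ (hE0 z) hz
  -- ### `h`-periodicity of `F'`
  have h2r : ((2 : ℕ) : ℝ) * (h : ℝ) = H := by rw [hHdef]; push_cast; ring
  have hhr : (0 : ℝ) < h := Nat.cast_pos.mpr hh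
  have hsuppf : ∀ m, ¬ 2 ∣ m → (qExpansion H ⇑f).coeff m = 0 := by
    intro m hm
    rw [← h2r, qExpansion_coeff_natMul f hhr hΓ two_ne_zero m, if_neg hm]
  have hF'per_h : ∀ τ : ℍ, F' ((h : ℝ) +ᵥ τ) = F' τ := by
    refine vadd_eq_of_coeff_eq_zero two_ne_zero hhr (by rw [h2r]; exact hF'nice) fun m hm ↦ ?_
    rw [h2r, hexpF', hσh, PowerSeries.coeff_map, hsuppf m hm, map_zero]
  -- ### the modular form
  obtain ⟨K, hK⟩ := exists_subgroup_slash_eq F' (2 * k + 1 : ℤ)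
  have hle : Γa ⊓ Γ₁ ≤ K := fun γ hγ ↦ (hK γ).mpr (hF'inv γ hγ)
  haveI hKfi : K.FiniteIndex := Subgroup.finiteIndex_of_le hle
  have hThK : ModularGroup.T ^ h ∈ K := by
    rw [hK]; funext z; rw [slash_T_pow_apply, hF'per_h]
  let fK : ModularForm (K : Subgroup (GL (Fin 2) ℝ)) (2 * k + 1 : ℤ) :=
    { toFun := F'
      slash_action_eq' := by
        intro γ hγ
        obtain ⟨A, hA, rfl⟩ := Subgroup.mem_map.mp hγ
        exact (hK A).mp hA
      holo' := hF'nice.2.1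
      bdd_at_cusps' := by
        intro c hc
        rw [Subgroup.IsArithmetic.isCusp_iff_isCusp_SL2Z] at hc
        rw [OnePoint.isBoundedAt_iff_forall_SL2Z hc]
        intro g _
        exact hbddF' g }
  have hKper : (h : ℝ) ∈ ((K : Subgroup (GL (Fin 2) ℝ))).strictPeriods := mem_strictPeriods_of_T_pow_mem hThK
  refine ⟨K, hKfi, fK, hKper, fun n ↦ ?_⟩
  have hcoe : (⇑fK : ℍ → ℂ) = F' := rfl
  rw [qExpansion_coeff_eq_coeff_natMul fK hhr hKper two_ne_zero n,
    qExpansion_coeff_eq_coeff_natMul f hhr hΓ two_ne_zero n, h2r, hcoe, hexpF', hσh,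
    PowerSeries.coeff_map]
  rfl

/-! ### All weights -/

/-- **Galois conjugates of modular forms on finite-index subgroups (Calegari–Dimitrov–Tang,
Remark 59, classical input).** For `f ∈ M_k(Γ)`, `Γ ≤ SL(2, ℤ)` of finite index with strict
period `h ≥ 1`, and a field automorphism `σ` of `ℂ`, there are a finite-index `Γ' ≤ SL(2, ℤ)`
with strict period `h` and `f' ∈ M_k(Γ')` whose `q`-expansion at the period `h` is `σ` applied
coefficientwise to that of `f`. (Negative weight: `f = 0`; even and odd weight:
`exists_conjugate_modularForm_even/odd`.)
[cite: CalegariDimitrovTang2025, Remark 59 ("the conjugates of a modular form on a finite index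
subgroup are modular forms on finite index subgroups")] -/
theorem exists_conjugate_modularForm {Γ : Subgroup SL(2, ℤ)} [Γ.FiniteIndex] (k : ℤ)
    (f : ModularForm (Γ : Subgroup (GL (Fin 2) ℝ)) k) {h : ℕ} (hh : 0 < h)
    (hΓ : (h : ℝ) ∈ (Γ : Subgroup (GL (Fin 2) ℝ)).strictPeriods) (σ : ℂ ≃+* ℂ) :
    ∃ (Γ' : Subgroup SL(2, ℤ)) (_ : Γ'.FiniteIndex)
      (f' : ModularForm (Γ' : Subgroup (GL (Fin 2) ℝ)) k),
      (h : ℝ) ∈ (Γ' : Subgroup (GL (Fin 2) ℝ)).strictPeriods ∧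
      ∀ n, (qExpansion (h : ℝ) f').coeff n = σ ((qExpansion (h : ℝ) f).coeff n) := by
  rcases lt_or_ge k 0 with hk | hk
  · -- negative weight: `f = 0`
    refine ⟨Γ, inferInstance, f, hΓ, fun n ↦ ?_⟩
    rw [modularForm_neg_weight_eq_zero hk f, qExpansion_zero, map_zero, map_zero]
  · obtain ⟨k', hk' | hk'⟩ := Int.even_or_odd' k
    · -- even weight `k = 2k'`
      lift k' to ℕ using (by omega)
      obtain ⟨Γ', hΓ', f', hper, hcoeff⟩ :=
        exists_conjugate_modularForm_even k' (ModularForm.mcast hk' f) hh hΓ σ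
      refine ⟨Γ', hΓ', ModularForm.mcast hk'.symm f', hper, fun n ↦ ?_⟩
      have e1 : (⇑(ModularForm.mcast hk'.symm f') : ℍ → ℂ) = ⇑f' := rfl
      have e2 : (⇑(ModularForm.mcast hk' f) : ℍ → ℂ) = ⇑f := rfl
      rw [e1, ← e2]
      exact hcoeff n
    · -- odd weight `k = 2k' + 1`
      lift k' to ℕ using (by omega)
      obtain ⟨Γ', hΓ', f', hper, hcoeff⟩ :=
        exists_conjugate_modularForm_odd k' (ModularForm.mcast hk' f) hh hΓ σ
      refine ⟨Γ', hΓ', ModularForm.mcast hk'.symm f', hper, fun n ↦ ?_⟩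
      have e1 : (⇑(ModularForm.mcast hk'.symm f') : ℍ → ℂ) = ⇑f' := rfl
      have e2 : (⇑(ModularForm.mcast hk' f) : ℍ → ℂ) = ⇑f := rfl
      rw [e1, ← e2]
      exact hcoeff n

/-- **The input `hB` of Remark 59, in the exact shape consumed by
`…_algInt.of_unboundedDenominators_of_hB`**: coefficients in a number field `K` embedded by
`σ₀`, and any other embedding `τ : K → ℂ` (extend `τ ∘ σ₀⁻¹` to an automorphism of `ℂ`,
`Literature.FieldTheory.AlgClosed.exists_ringEquiv_apply_eq`, and apply
`exists_conjugate_modularForm`). [cite: CalegariDimitrovTang2025, Remark 59] -/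
theorem galois_conjugate_hB (Γ : Subgroup SL(2, ℤ)) [Γ.FiniteIndex] (k : ℤ)
    (f : ModularForm (Γ : Subgroup (GL (Fin 2) ℝ)) k) (h : ℕ) (hh : 0 < h)
    (hΓ : (h : ℝ) ∈ (Γ : Subgroup (GL (Fin 2) ℝ)).strictPeriods)
    (K : Type) [Field K] [NumberField K] (σ₀ : K →+* ℂ) (b : ℕ → K)
    (hb : ∀ n : ℕ, PowerSeries.coeff n (qExpansion (h : ℝ) f) = σ₀ (b n)) (τ : K →+* ℂ) :
    ∃ (Γ' : Subgroup SL(2, ℤ)) (_ : Γ'.FiniteIndex)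
      (f' : ModularForm (Γ' : Subgroup (GL (Fin 2) ℝ)) k),
      ((h : ℝ) ∈ (Γ' : Subgroup (GL (Fin 2) ℝ)).strictPeriods) ∧
      ∀ n : ℕ, PowerSeries.coeff n (qExpansion (h : ℝ) f') = τ (b n) := by
  have hΩ : ℵ₀ < #ℂ := by rw [Cardinal.mk_complex]; exact Cardinal.aleph0_lt_continuum
  have hKc : Countable K :=
    Function.Injective.countable (Module.finBasis ℚ K).equivFun.injective
  have hK : #K ≤ ℵ₀ := Cardinal.mk_le_aleph0_iff.mpr hKc
  obtain ⟨σ, hσ⟩ := Literature.FieldTheory.AlgClosed.exists_ringEquiv_apply_eq hΩ hK σ₀ τ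
  obtain ⟨Γ', hΓ', f', hper, hcoeff⟩ := exists_conjugate_modularForm k f hh hΓ σ
  exact ⟨Γ', hΓ', f', hper, fun n ↦ by rw [hcoeff n, hb n, hσ]⟩

end ModularLambda

/-- **The algebraic-integer version of the unbounded denominators theorem follows from the
integer version** (Calegari–Dimitrov–Tang, Remarks 58–59): with the input `hA` (one number
field carries all coefficients; `ModularFormCoefficientField`) and `hB` (`galois_conjugate_hB`)
of Voight's argument now proved, `…_algInt.of_unboundedDenominators_of_hB` closes the reduction.
[cite: CalegariDimitrovTang2025, Remarks 58–59] -/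
theorem CalegariDimitrovTang2025_unboundedDenominators_algInt.of_unboundedDenominators
    (hCDT : CalegariDimitrovTang2025_unboundedDenominators) :
    CalegariDimitrovTang2025_unboundedDenominators_algInt :=
  CalegariDimitrovTang2025_unboundedDenominators_algInt.of_unboundedDenominators_of_hB hCDT
    (fun Γ _ k f h hh hΓ K _ _ σ₀ b hb τ ↦ ModularLambda.galois_conjugate_hB Γ k f h hh hΓ K σ₀ b hb τ)

/-- **… and from the core case of Theorem 1 alone** (CDT's groups `G_N`, weight `12m`, integral
`f ≠ 0`; the tree's `…_algInt.of_hB_of_core_wohlfahrtLevel` with `hB` discharged).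
[cite: CalegariDimitrovTang2025, Remarks 58–59, §4.2 Lemma 24] -/
theorem CalegariDimitrovTang2025_unboundedDenominators_algInt.of_core_wohlfahrtLevel
    (Hcore : ∀ (G : Subgroup SL(2, ℤ)) [G.FiniteIndex], G.Normal → (-1 : SL(2, ℤ)) ∈ G →
      (∀ γ ∈ G, γ ∈ CongruenceSubgroup.Gamma (wohlfahrtLevel G) ∨
        -γ ∈ CongruenceSubgroup.Gamma (wohlfahrtLevel G)) →
      ¬ CongruenceSubgroup.IsCongruenceSubgroup G →
      ∀ (m : ℕ), 1 ≤ m → ∀ (f : ModularForm (G : Subgroup (GL (Fin 2) ℝ)) (12 * (m : ℤ))),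
      f ≠ 0 →
      (∀ n : ℕ, ∃ z : ℤ,
        PowerSeries.coeff n (qExpansion (wohlfahrtLevel G : ℝ) f) = (z : ℂ)) →
      ∃ (Γ' : Subgroup SL(2, ℤ)) (g : ModularForm (Γ' : Subgroup (GL (Fin 2) ℝ)) (12 * (m : ℤ))),
        CongruenceSubgroup.IsCongruenceSubgroup Γ' ∧ (g : ℍ → ℂ) = f) :
    CalegariDimitrovTang2025_unboundedDenominators_algInt :=
  CalegariDimitrovTang2025_unboundedDenominators_algInt.of_hB_of_core_wohlfahrtLevel
    (fun Γ _ k f h hh hΓ K _ _ σ₀ b hb τ ↦ ModularLambda.galois_conjugate_hB Γ k f h hh hΓ K σ₀ b hb τ) Hcore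

end Literature.NumberTheory.Automorphic
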